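import Literature.NumberTheory.EllipticCurves.HeegnerPointsKolyvaginPrimaryCongruenceProofs
import Literature.NumberTheory.EllipticCurves.LFunctionPrimeCoeff
import HarnessLib

/-!
# Route `KolyvaginDepthDoor` (stmt-BirchSwinnertonDyer-21765) — towards Gross (3.2) modulo `p^M` from
# W. Zhang's congruences: `Frob_ℓ² = 1` on `E[p^M]` when `p^M ∣ ℓ + 1` and `p^M ∣ a_ℓ`

Helper file (`--supports stmt-BirchSwinnertonDyer-21765 --as helper`); it closes nothing and BSD is
not proved by it.

The McCallum leaves of this route's door are stated at every level `p^M` in W. ZHANG's currency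
(`M ≤ M(ℓ) = min{v_p(ℓ+1), v_p(a_ℓ)}`), while the tree's local theorems at a Kolyvagin place (x11b3,
Gross cluster) take GROSS's (3.2) at level `p^M`, `FrobEqFrobInfty W K (p^M) ℓ`. The tree has
Gross ⟹ Zhang at `p^M` (`pow_dvd_add_one_of_frobEqFrobInfty`, `pow_dvd_frobeniusTraceAt_of_frobEqFrobInfty`)
and Zhang ⟹ Gross at `p` only (`JET.ZhangGross.frobEqFrobInfty_of_zhang`). This file is the first
step of Zhang ⟹ Gross modulo `p^M`: the CONVERSE of the tree's `toZModPow_trace_galoisRepTate_eq_zero`.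

* `smul_smul_eq_self_of_toZModPow_trace_det` — over any perfect field: an element of `Γ_F` whose
  action on `T_ℓ E` has trace `≡ 0` and determinant `≡ −1 (mod ℓ^{n+1})` is an INVOLUTION of
  `E[ℓ^{n+1}]` (`2 × 2` Cayley–Hamilton in the reduced matrix: `N² = (tr N) N − det N = 1`).
* `frob_smul_smul_eq_self_of_pow_dvd` — **`Frob_ℓ² = 1` on `E[p^{n+1}](ℚ̄)`** for `E/ℚ` with good
  reduction at `ℓ ≠ p` and `p^{n+1} ∣ ℓ + 1`, `p^{n+1} ∣ a_ℓ` (trace `a_ℓ`, determinant `ℓ`: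
  Silverman C.21 Remark 21.3, the tree's `…_frobenius_of_hasGoodReductionAt_holds` facts).

References: [GrossLMS1991] §3 (3.2)–(3.3); [McCallumLMS1991] §4 (Kolyvagin primes of level `M`);
[SilvermanAEC2009] III §7, C.21 Remark 21.3; [WZhang2014] Notations (xii).
-/

set_option linter.dupNamespace false

noncomputable section

open scoped Classical

namespace Summit.BirchSwinnertonDyer.BirchSwinnertonDyer.Theorems.KolyvaginDepthDoor

open Literature.NumberTheory.EllipticCurves Literature.NumberTheory.GaloisRepresentations
  WeierstrassCurve NumberField IsDedekindDomain Field

universe u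

section Trace

variable {F : Type u} [Field F] (V : WeierstrassCurve F) (ℓ : ℕ) [Fact ℓ.Prime]

/-- Integer multiples of an `N`-torsion point only depend on the residue class modulo `N`.
[folklore] -/
theorem zsmul_eq_zsmul_of_intCast_eq {A : Type*} [AddCommGroup A] {N : ℕ} {P : A}
    (hP : (N : ℤ) • P = 0) {u u' : ℤ} (h : (u : ZMod N) = (u' : ZMod N)) : u • P = u' • P := by
  obtain ⟨k, hk⟩ := (ZMod.intCast_eq_intCast_iff_dvd_sub u' u N).mp h.symm
  have : u = u' + N * k := by linarith
  rw [this, add_zsmul, mul_comm, mul_zsmul, hP, zsmul_zero, add_zero]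

/-- **An element of trace `≡ 0` and determinant `≡ −1 (mod ℓ^{n+1})` on `T_ℓ E` is an involution
of `E[ℓ^{n+1}]`** (`E` over a perfect field, `ℓ ≠ char F`): in the images `P₀, P₁ ∈ E[ℓ^{n+1}]` of a
`ℤ_ℓ`-basis of `T_ℓ E` (which generate `E[ℓ^{n+1}]`, `T_ℓ E → E[ℓ^{n+1}]` being onto) the reduced
matrix `N` of `σ` has `N² = (tr N)·N − (det N)·1 = 1` — the converse of the tree's
`toZModPow_trace_galoisRepTate_eq_zero`. [cite: SilvermanAEC2009, III.§7] -/
theorem smul_smul_eq_self_of_toZModPow_trace_det [PerfectField F] [V.IsElliptic] (hℓ : (ℓ : F) ≠ 0)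
    (n : ℕ) (σ : Field.absoluteGaloisGroup F)
    (htr : PadicInt.toZModPow (n + 1)
        (LinearMap.trace ℤ_[ℓ] (V.tateModule ℓ) (V.galoisRepTate ℓ σ)) = 0)
    (hdet : PadicInt.toZModPow (n + 1)
        (LinearMap.det (V.galoisRepTate ℓ σ : V.tateModule ℓ →ₗ[ℤ_[ℓ]] V.tateModule ℓ)) = -1)
    {P : V.geomPoints} (hP : P ∈ geomTorsion V ((ℓ ^ (n + 1) : ℕ) : ℤ)) : σ • σ • P = P := by
  have hp : ℓ.Prime := Fact.out
  haveI := module_free_tateModule_holds V ℓ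
  haveI := module_finite_tateModule_holds V ℓ
  let b := Module.finBasisOfFinrankEq ℤ_[ℓ] (V.tateModule ℓ) (finrank_tateModule_eq_two_holds V ℓ hℓ)
  set N : ℕ := ℓ ^ (n + 1) with hN
  haveI : NeZero N := ⟨pow_ne_zero _ hp.ne_zero⟩
  set red : ℤ_[ℓ] →+* ZMod N := PadicInt.toZModPow (n + 1) with hred
  set M := LinearMap.toMatrix b b (V.galoisRepTate ℓ σ) with hMdef
  set P₀ := TateModule.proj ℓ (n + 1) (b 0) with hP₀
  set P₁ := TateModule.proj ℓ (n + 1) (b 1) with hP₁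
  have hP₀N : (N : ℤ) • P₀ = 0 := by
    rw [natCast_zsmul, hP₀, hN]; exact TateModule.pow_smul_proj (n + 1) (b 0)
  have hP₁N : (N : ℤ) • P₁ = 0 := by
    rw [natCast_zsmul, hP₁, hN]; exact TateModule.pow_smul_proj (n + 1) (b 1)
  -- ### the columns of `σ` on `P₀, P₁`
  have hcol : ∀ j, σ • TateModule.proj ℓ (n + 1) (b j) =
      ((red (M 0 j)).val : ℤ) • P₀ + ((red (M 1 j)).val : ℤ) • P₁ := fun j ↦ by
    have h1 : σ • TateModule.proj ℓ (n + 1) (b j) =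
        TateModule.proj ℓ (n + 1) (V.galoisRepTate ℓ σ (b j)) := by
      rw [galoisRepTate_apply_apply, TateModule.proj_smul_of_distribMulAction]
    rw [h1, proj_eq_sum_repr V ℓ b _ (n + 1), hMdef, LinearMap.toMatrix_apply,
      LinearMap.toMatrix_apply, natCast_zsmul, natCast_zsmul]
  set a := red (M 0 0) with ha
  set bb := red (M 0 1) with hbb
  set c := red (M 1 0) with hc
  set d := red (M 1 1) with hd
  have hσ0 : σ • P₀ = (a.val : ℤ) • P₀ + (c.val : ℤ) • P₁ := hcol 0
  have hσ1 : σ • P₁ = (bb.val : ℤ) • P₀ + (d.val : ℤ) • P₁ := hcol 1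
  have hzs : ∀ (g : Field.absoluteGaloisGroup F) (k : ℤ) (X : V.geomPoints),
      g • (k • X) = k • (g • X) := fun g k X ↦ smul_comm g k X
  -- ### trace and determinant in coordinates
  have htr' : a + d = 0 := by
    rw [LinearMap.trace_eq_matrix_trace ℤ_[ℓ] b, ← hMdef, Matrix.trace_fin_two, map_add] at htr
    exact htr
  have hdet' : a * d - bb * c = -1 := by
    rw [← hdet, ← LinearMap.det_toMatrix b, ← hMdef, RingHom.map_det, Matrix.det_fin_two]
    simp only [RingHom.mapMatrix_apply, Matrix.map_apply]
    rw [ha, hbb, hc, hd]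
  -- ### `σ² = 1` on `P₀` and `P₁`
  have hsq0 : σ • σ • P₀ = P₀ := by
    rw [hσ0, smul_add, hzs, hzs, hσ0, hσ1]
    have hcalc : (a.val : ℤ) • ((a.val : ℤ) • P₀ + (c.val : ℤ) • P₁) +
        (c.val : ℤ) • ((bb.val : ℤ) • P₀ + (d.val : ℤ) • P₁) =
        ((a.val : ℤ) * a.val + (c.val : ℤ) * bb.val) • P₀ +
          ((a.val : ℤ) * c.val + (c.val : ℤ) * d.val) • P₁ := by
      simp only [add_zsmul, mul_zsmul, zsmul_add]; abel
    rw [hcalc, zsmul_eq_zsmul_of_intCast_eq hP₀N (u' := 1) (by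
        push_cast; simp only [ZMod.natCast_zmod_val]; linear_combination a * htr' - hdet'),
      zsmul_eq_zsmul_of_intCast_eq hP₁N (u' := 0) (by
        push_cast; simp only [ZMod.natCast_zmod_val]; linear_combination c * htr'),
      one_zsmul, zero_zsmul, add_zero]
  have hsq1 : σ • σ • P₁ = P₁ := by
    rw [hσ1, smul_add, hzs, hzs, hσ0, hσ1]
    have hcalc : (bb.val : ℤ) • ((a.val : ℤ) • P₀ + (c.val : ℤ) • P₁) +
        (d.val : ℤ) • ((bb.val : ℤ) • P₀ + (d.val : ℤ) • P₁) =
        ((bb.val : ℤ) * a.val + (d.val : ℤ) * bb.val) • P₀ +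
          ((bb.val : ℤ) * c.val + (d.val : ℤ) * d.val) • P₁ := by
      simp only [add_zsmul, mul_zsmul, zsmul_add]; abel
    rw [hcalc, zsmul_eq_zsmul_of_intCast_eq hP₀N (u' := 0) (by
        push_cast; simp only [ZMod.natCast_zmod_val]; linear_combination bb * htr'),
      zsmul_eq_zsmul_of_intCast_eq hP₁N (u' := 1) (by
        push_cast; simp only [ZMod.natCast_zmod_val]; linear_combination d * htr' - hdet'),
      one_zsmul, zero_zsmul, zero_add]
  -- ### every `P ∈ E[ℓ^{n+1}]` is a combination of `P₀, P₁`
  obtain ⟨t, ht⟩ := proj_surjective_of_isAlgClosed_holds V ℓ (n + 1) hP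
  rw [← ht, proj_eq_sum_repr V ℓ b t (n + 1), ← hP₀, ← hP₁, smul_add, smul_add, ← natCast_zsmul,
    ← natCast_zsmul, hzs, hzs, hzs, hzs, hsq0, hsq1]

end Trace

section Rational

variable (W : WeierstrassCurve ℚ) [W.IsElliptic]

/-- **`Frob_ℓ² = 1` on `E[p^{n+1}](ℚ̄)` at a Zhang–Kolyvagin prime of index `≥ n + 1`.** For
`E = W/ℚ` elliptic with good reduction at the place `v` above the prime `ℓ ≠ p`, `𝔓 ∣ v` a prime of
`\bar ℤ`, `h` an arithmetic Frobenius at `𝔓`, and `p^{n+1} ∣ ℓ + 1`, `p^{n+1} ∣ a_ℓ`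
(`a_ℓ = W.frobeniusTraceAt v`): `h (h P) = P` for every `P ∈ E[p^{n+1}]`. Proof: `tr(h | T_p E) = a_ℓ`
and `det(h | T_p E) = N v = ℓ` (Silverman C.21 Remark 21.3; the tree's
`trace/det_galoisRepTate_frobenius_of_hasGoodReductionAt_holds`), so modulo `p^{n+1}` the trace is
`0` and the determinant `−1`; then `smul_smul_eq_self_of_toZModPow_trace_det`.
[cite: GrossLMS1991, §3 (3.2)–(3.3)] [cite: McCallumLMS1991, §4] [cite: SilvermanAEC2009, C.21 Remark 21.3] -/
theorem frob_smul_smul_eq_self_of_pow_dvd {p : ℕ} [Fact p.Prime] (n : ℕ) {ℓ : ℕ} (hℓ : ℓ.Prime)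
    (hℓp : ℓ ≠ p) {v : HeightOneSpectrum (𝓞 ℚ)} (hℓv : (ℓ : 𝓞 ℚ) ∈ v.asIdeal)
    (hgood : W.HasGoodReductionAt v) {𝔓 : Ideal (absIntegers (𝓞 ℚ) ℚ)} (h𝔓 : 𝔓 ∈ v.primesAbove)
    {h : absoluteGaloisGroup ℚ} (hh : IsArithFrobAt (𝓞 ℚ) h 𝔓)
    (hℓ1 : p ^ (n + 1) ∣ ℓ + 1) (ha : ((p : ℤ) ^ (n + 1)) ∣ W.frobeniusTraceAt v)
    {P : W.geomPoints} (hP : P ∈ geomTorsion W ((p ^ (n + 1) : ℕ) : ℤ)) : h • h • P = P := by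
  have hp : p.Prime := Fact.out
  have hpQ : (p : ℚ) ≠ 0 := by exact_mod_cast hp.ne_zero
  have hpv : (p : 𝓞 ℚ) ∉ v.asIdeal := not_natCast_mem_of_prime_ne hℓ hp hℓp v hℓv
  -- `tr = a_ℓ ≡ 0`
  have htr := W.trace_galoisRepTate_frobenius_of_hasGoodReductionAt_holds p v hpv hgood h𝔓 hh
  have htr0 : PadicInt.toZModPow (n + 1)
      (LinearMap.trace ℤ_[p] (W.tateModule p) (W.galoisRepTate p h)) = 0 := by
    rw [htr, map_intCast, ZMod.intCast_zmod_eq_zero_iff_dvd]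
    exact_mod_cast ha
  -- `det = N v = ℓ ≡ -1`
  have hdet := W.det_galoisRepTate_frobenius_of_hasGoodReductionAt_holds p v hpv hgood h𝔓 hh
  have hcard : Nat.card (IsLocalRing.ResidueField (v.adicCompletionIntegers ℚ)) = ℓ := by
    rw [natCard_residueField_adicCompletionIntegers, primesEquiv_eq_of_natCast_mem hℓ hℓv]
  have hdet1 : PadicInt.toZModPow (n + 1)
      (LinearMap.det (W.galoisRepTate p h : W.tateModule p →ₗ[ℤ_[p]] W.tateModule p)) = -1 := by
    rw [hdet, hcard, map_natCast]
    have h3 : ((ℓ + 1 : ℕ) : ZMod (p ^ (n + 1))) = 0 := by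
      rw [ZMod.natCast_eq_zero_iff]; exact hℓ1
    rw [Nat.cast_add, Nat.cast_one] at h3
    exact eq_neg_of_add_eq_zero_left h3
  exact smul_smul_eq_self_of_toZModPow_trace_det W p hpQ n h htr0 hdet1 hP

end Rational

end Summit.BirchSwinnertonDyer.BirchSwinnertonDyer.Theorems.KolyvaginDepthDoor

end
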